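import Summits.CriticalPhenomena.CardyFormulaZ2.Theorems.CardyMeckeFlipFlipErgodicityZ2StubLatticeSecondMomentEdgeArm

/-!
# Crux `FlipErgodicityZ2` (stmt-CriticalPhenomena-14825), line `registered`, stub
# `stub_latticeSecondMoment`: mesh bookkeeping (scales, edge counts, the rate)

Route `Summits/CriticalPhenomena/CardyFormulaZ2/Theses/CardyMeckeFlip`.  Helper file (supports the
crux item).  The discretisation bookkeeping of the second-moment computation for the
Garban–Pete–Schramm pivotal measures of bond-`ℤ²` at mesh `δ` (GPS 2013, §4.3–4.4, "issues coming
from the discrete lattice"): with `n = ⌊1/δ⌋` the lattice scale of Euclidean radius `1` and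
`m = ⌊min(ε,2) n / 4⌋` the lattice scale of the `ε`-blocks,

* `scales_of_small_mesh` — for `δ ≤ min(ε,2)/(40A)`: `1 ≤ n ≤ 1/δ`, `8A ≤ m < n`,
  `min(ε,2)/8 ≤ m/n` and `2δm + δ ≤ ε` (the box `x + [-m,m]²` is drawn inside the `ε`-disc around
  the midpoint of the edge at `x`);
* `card_edges_le` — the edges of `δℤ²` whose midpoints lie in the disc of radius `R₀` number at
  most `50 (⌈R₀⌉+1)² n²`;
* `pivotalRate_le` — GPS's rate `r(δ) = δ²/α₄(δ,1)` is at most `1/(n² a(n))`,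
  `a(n) = P(edgeFourArm [-n,n]² 0 0) = α₄(δ,1)` (`z2EdgeFourArmProb_eq`).
-/

noncomputable section

open MeasureTheory Set Metric
open Literature.Probability.Percolation Literature.Probability.LatticeModels

namespace Summit.CriticalPhenomena.CardyFormulaZ2.Theorems.CardyMeckeFlip

/-- **The two lattice scales at a small mesh.**  For `A ≥ 1`, `ε > 0` and
`0 < δ ≤ min(ε,2)/(40A)`, the scales `n = ⌊1/δ⌋`, `m = ⌊min(ε,2) n/4⌋` satisfy `1 ≤ n ≤ 1/δ`,
`8A ≤ m < n`, `min(ε,2)/8 ≤ m/n` and `2δm + δ ≤ ε`. [folklore] -/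
theorem scales_of_small_mesh :
    ∀ (ε δ : ℝ) (A n m : ℕ), 1 ≤ A → 0 < ε → 0 < δ → δ ≤ min ε 2 / (40 * A) →
      n = ⌊δ⁻¹⌋₊ → m = ⌊min ε 2 * n / 4⌋₊ →
        1 ≤ n ∧ (n : ℝ) ≤ δ⁻¹ ∧ 8 * A ≤ m ∧ m < n ∧ min ε 2 / 8 ≤ (m : ℝ) / n ∧
          2 * δ * m + δ ≤ ε := by
  intro ε δ A n m hA hε hδ hδ₀ hn hm
  set ε' := min ε 2 with hε'
  have hε'0 : 0 < ε' := lt_min hε two_pos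
  have hε'2 : ε' ≤ 2 := min_le_right _ _
  have hε'ε : ε' ≤ ε := min_le_left _ _
  have hA1 : (1 : ℝ) ≤ A := by exact_mod_cast hA
  have hδ₀pos : 0 < ε' / (40 * A) := by positivity
  -- `1/δ ≥ 40A/ε'`
  have hinv : 40 * (A : ℝ) / ε' ≤ δ⁻¹ := by
    have := inv_anti₀ hδ hδ₀
    rwa [inv_div] at this
  have hnle : (n : ℝ) ≤ δ⁻¹ := by rw [hn]; exact Nat.floor_le (inv_nonneg.2 hδ.le)
  have hnlt : δ⁻¹ < (n : ℝ) + 1 := by rw [hn]; exact Nat.lt_floor_add_one _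
  have hn_lb : 40 * (A : ℝ) / ε' - 1 < n := by linarith
  have h40 : (20 : ℝ) * A ≤ 40 * (A : ℝ) / ε' := by
    rw [le_div_iff₀ hε'0]; nlinarith
  have hn1 : 1 ≤ n := by
    have : (1 : ℝ) ≤ n := by linarith
    exact_mod_cast this
  have hn0 : (0 : ℝ) < n := by exact_mod_cast hn1
  -- `m`
  have hmle : (m : ℝ) ≤ ε' * n / 4 := by rw [hm]; exact Nat.floor_le (by positivity)
  have hmlt : ε' * n / 4 < (m : ℝ) + 1 := by rw [hm]; exact Nat.lt_floor_add_one _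
  have hkey : 10 * (A : ℝ) - 1 / 2 ≤ ε' * n / 4 := by
    -- `ε' n / 4 ≥ ε' (40A/ε' - 1)/4 = 10 A - ε'/4 ≥ 10 A - 1/2`
    have h1 : ε' * (40 * (A : ℝ) / ε' - 1) / 4 ≤ ε' * n / 4 := by
      have := hn_lb.le
      gcongr
    have h2 : ε' * (40 * (A : ℝ) / ε' - 1) / 4 = 10 * A - ε' / 4 := by
      field_simp
      ring
    linarith
  have hm8 : 8 * A ≤ m := by
    have h1 : ((8 * A : ℕ) : ℝ) < m + 1 := by push_cast; linarith
    have h2 : 8 * A < m + 1 := by exact_mod_cast h1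
    omega
  have hmn : m < n := by
    have : (m : ℝ) < n := by nlinarith
    exact_mod_cast this
  refine ⟨hn1, hnle, hm8, hmn, ?_, ?_⟩
  · -- `m/n ≥ ε'/4 - 1/n ≥ ε'/8`
    rw [le_div_iff₀ hn0]
    have h8 : (8 : ℝ) / ε' ≤ n := by
      have : (8 : ℝ) / ε' ≤ 40 * (A : ℝ) / ε' - 1 := by
        rw [div_le_iff₀ hε'0, sub_mul, div_mul_cancel₀ _ hε'0.ne']
        nlinarith
      linarith
    have : (1 : ℝ) ≤ ε' * n / 8 := by
      rw [le_div_iff₀ (by norm_num : (0:ℝ) < 8)]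
      have := (div_le_iff₀ hε'0).1 h8
      linarith
    linarith
  · -- `2δm + δ ≤ ε'/2 + δ ≤ ε`
    have hδn : δ * n ≤ 1 := by
      have := mul_le_mul_of_nonneg_left hnle hδ.le
      rwa [mul_inv_cancel₀ hδ.ne'] at this
    have hδ1 : δ ≤ ε' / 40 := by
      refine hδ₀.trans ?_
      rw [div_le_div_iff₀ (by positivity) (by norm_num)]
      nlinarith
    calc 2 * δ * m + δ ≤ 2 * δ * (ε' * n / 4) + δ := by gcongr
      _ = ε' / 2 * (δ * n) + δ := by ring
      _ ≤ ε' / 2 * 1 + ε' / 40 := by gcongr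
      _ ≤ ε := by linarith

/-- **Counting the charged edges**: at mesh `0 < δ ≤ 1`, the edges `(x, i)` of `ℤ²` whose drawn
midpoints lie in the disc of radius `R₀ ≥ 0` number at most `50 (⌈R₀⌉ + 1)² ⌊1/δ⌋²` in any
finite set. [folklore] -/
theorem card_edges_le {δ : ℝ} (hδ : 0 < δ) (hδ1 : δ ≤ 1) {R₀ : ℝ} (hR₀ : 0 ≤ R₀)
    (E : Finset (Site 2 × Fin 2))
    (hE : ∀ p ∈ E, edgeMidpoint δ p.1 p.2 ∈ closedBall (0 : ℂ) R₀) :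
    (E.card : ℝ) ≤ 50 * ((⌈R₀⌉₊ : ℝ) + 1) ^ 2 * (⌊δ⁻¹⌋₊ : ℝ) ^ 2 := by
  classical
  set n := ⌊δ⁻¹⌋₊ with hn
  set J₀ : ℕ := ⌈R₀⌉₊ + 1 with hJ₀
  have hnle : (n : ℝ) ≤ δ⁻¹ := Nat.floor_le (inv_nonneg.2 hδ.le)
  have hnlt : δ⁻¹ < (n : ℝ) + 1 := Nat.lt_floor_add_one _
  have hn1 : 1 ≤ n := Nat.le_floor (by rw [Nat.cast_one]; exact one_le_inv_iff₀.2 ⟨hδ, hδ1⟩)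
  have hJ : R₀ + 1 ≤ J₀ := by
    rw [hJ₀]; push_cast; linarith [Nat.le_ceil R₀]
  -- every charged edge starts in the box of radius `J₀ (n+1)`
  have hbox : ∀ p ∈ E, p.1 ∈ box 2 (J₀ * (n + 1)) := by
    intro p hp
    have hmid := hE p hp
    rw [mem_closedBall, dist_zero_right] at hmid
    have hnorm : ‖meshPoint δ p.1‖ ≤ J₀ := by
      have h1 : ‖meshPoint δ p.1‖ ≤ ‖edgeMidpoint δ p.1 p.2‖ +
          dist (meshPoint δ p.1) (edgeMidpoint δ p.1 p.2) := by
        have := norm_le_norm_add_norm_sub' (meshPoint δ p.1) (edgeMidpoint δ p.1 p.2)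
        rwa [← dist_eq_norm] at this
      have h2 := dist_meshPoint_edgeMidpoint_le hδ p.1 p.2
      linarith
    rw [mem_box]
    intro k
    have hk : |δ * (p.1 k : ℝ)| ≤ J₀ := by
      fin_cases k
      · exact le_trans (by simpa using Complex.abs_re_le_norm (meshPoint δ p.1)) hnorm
      · exact le_trans (by simpa using Complex.abs_im_le_norm (meshPoint δ p.1)) hnorm
    rw [abs_mul, abs_of_pos hδ] at hk
    have hk' : |(p.1 k : ℝ)| < J₀ * ((n : ℝ) + 1) := by
      have h1 : |(p.1 k : ℝ)| ≤ J₀ * δ⁻¹ := by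
        rw [← div_eq_mul_inv, le_div_iff₀ hδ, mul_comm]; exact hk
      have hJ0 : (0 : ℝ) < J₀ := by linarith
      nlinarith
    have hk'' : |p.1 k| < ((J₀ * (n + 1) : ℕ) : ℤ) := by
      have : ((|p.1 k| : ℤ) : ℝ) < ((J₀ * (n + 1) : ℕ) : ℤ) := by
        rw [Int.cast_abs]; push_cast; exact hk'
      exact_mod_cast this
    constructor <;> [linarith [(abs_lt.1 hk'').1]; linarith [(abs_lt.1 hk'').2]]
  have hsub : E ⊆ box 2 (J₀ * (n + 1)) ×ˢ (Finset.univ : Finset (Fin 2)) := by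
    intro p hp
    exact Finset.mem_product.2 ⟨hbox p hp, Finset.mem_univ _⟩
  have hcard := Finset.card_le_card hsub
  rw [Finset.card_product, card_box, Finset.card_univ, Fintype.card_fin] at hcard
  have hcast : (E.card : ℝ) ≤ (2 * (J₀ : ℝ) * (n + 1) + 1) ^ 2 * 2 := by
    have : (E.card : ℝ) ≤ (((2 * (J₀ * (n + 1)) + 1) ^ 2 * 2 : ℕ) : ℝ) := by exact_mod_cast hcard
    refine this.trans (le_of_eq ?_)
    push_cast; ring
  have hn1' : (1 : ℝ) ≤ n := by exact_mod_cast hn1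
  have hJ1 : (1 : ℝ) ≤ J₀ := by rw [hJ₀]; push_cast; linarith
  have h5 : 2 * (J₀ : ℝ) * (n + 1) + 1 ≤ 5 * J₀ * n := by nlinarith
  calc (E.card : ℝ) ≤ (2 * (J₀ : ℝ) * (n + 1) + 1) ^ 2 * 2 := hcast
    _ ≤ (5 * (J₀ : ℝ) * n) ^ 2 * 2 := by gcongr
    _ = 50 * ((⌈R₀⌉₊ : ℝ) + 1) ^ 2 * (n : ℝ) ^ 2 := by rw [hJ₀]; push_cast; ring

/-- **GPS's rate is at most `1/(n² a(n))`**: for `0 < δ ≤ 1` and `n = ⌊1/δ⌋`,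
`pivotalRate δ = δ²/α₄(δ,1) ≤ 1/(n² · P(edgeFourArm [-n,n]² 0 0))` whenever the latter probability
is positive. [folklore] -/
theorem pivotalRate_le {δ : ℝ} (hδ : 0 < δ) (hδ1 : δ ≤ 1)
    (ha : 0 < (bondPercolation (zdGraph 2) half).real
      (edgeFourArm (↑(box 2 ⌊δ⁻¹⌋₊) : Set (Site 2)) 0 0)) :
    pivotalRate δ ≤ 1 / ((⌊δ⁻¹⌋₊ : ℝ) ^ 2 *
      (bondPercolation (zdGraph 2) half).real (edgeFourArm (↑(box 2 ⌊δ⁻¹⌋₊) : Set (Site 2)) 0 0)) := by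
  set n := ⌊δ⁻¹⌋₊ with hn
  have hnle : (n : ℝ) ≤ δ⁻¹ := Nat.floor_le (inv_nonneg.2 hδ.le)
  have hn1 : 1 ≤ n := Nat.le_floor (by rw [Nat.cast_one]; exact one_le_inv_iff₀.2 ⟨hδ, hδ1⟩)
  have hn0 : (0 : ℝ) < n := by exact_mod_cast hn1
  rw [pivotalRate, z2EdgeFourArmProb_eq hδ, ← hn, div_le_div_iff₀ ha (by positivity)]
  have hδn : δ * n ≤ 1 := by
    have := mul_le_mul_of_nonneg_left hnle hδ.le
    rwa [mul_inv_cancel₀ hδ.ne'] at this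
  have : (δ * n) ^ 2 ≤ 1 := by
    rw [sq_le_one_iff₀ (by positivity)]; exact hδn
  nlinarith [this, ha]

end Summit.CriticalPhenomena.CardyFormulaZ2.Theorems.CardyMeckeFlip

end
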